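import Mathlib
import Summits.CriticalPhenomena.PercolationContinuityZ3.Theorems.PercNearOneGluingNoHeavyLowerTailIntervalCertificates

/-!
# Tops suffice: the two-pool difference inequality (W′), proved by an interval certificate (hp-7 gen 74)

Support file for crux `stmt-CriticalPhenomena-4575` (route `PercNearOneGluingNoHeavy`), hull-port seat `prim-hp-7`
(generation 74); `--supports stmt-CriticalPhenomena-4575`.  No `sorry`.  Memo:
`run/shared/lean/prim/prim-hp-7/FROM-prim-hp-7-g74-TOPS-SUFFICE.md`.

Gen 73 (memo `FROM-prim-hp-7-g73-MS2-HALL.md` §0 (F)) isolated the hypothesis-free ONE-BLOCK half of the `tops`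
sparsification of the second-order Marica–Schönheim conjecture (`GeneratedDonors.MS2Tops`) and verified it by SAT on `2^[≤4]`:

**(W′) 'tops suffice'.**  For any finite family `P` of finite sets and any family `D` of non-members each lying below
some member, `#P + #D ≤ #(P \\ P ∪ Tops \\ D)`, where `Tops = {t ∈ P | ∃ d ∈ D, d ⊆ t}` are the members containing SOME
designated set, and every top is used as a minuend for EVERY designated set.  (With all of `P` as minuends this is the
Aharoni–Holzman complement form of the Ahlswede–Daykin inequality; with `D = ∅` it is Marica–Schönheim; the content of
(W′) is in the members of `P` that lie below no top.)

This file PROVES (W′) (`card_add_card_le_card_diffs_union_tops_diffs`) as the case `𝒜 = B₀ = P`, `B₁ = D`, `𝒯 = Tops`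
of a two-pool inequality:

**Theorem (`card_add_card_le_card_of_two_pools`).**  Let `𝒯 ⊆ 𝒜` be finite families of finite sets ('tops' among
'minuends'), `B₀ ⊆ 𝒜` and `B₁` disjoint families of 'items' such that every `c ∈ B₁` lies below some top and every
`b ∈ B₀` containing some `c ∈ B₁` is itself a top.  Then every family `T ⊇ 𝒜 \\ B₀ ∪ 𝒯 \\ B₁` has `#B₀ + #B₁ ≤ #T`.

**Proof** — an interval certificate in the sense of `IntervalCertificate.card_le_card_of_certificate` (based Möbius
rows, block-unitriangular pairing matrix).  Inside the ground set `S = ⋃ 𝒜`: for an item `b ∈ B₀` take the interval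
`[∅, b]` (base `L = ∅`, cap `U = b`); for `c ∈ B₁` choose a top `t_c ⊇ c` and take the interval `[t_c \ c, t_c]`
(the 'row `[t \ d, t]`' of the gen-73 menu); the column of an item `j` is `V = S \ j`.  Then `U ∩ V = cap \ j` is
`b \ j` (in `T` whenever `j ∈ B₀`, or `j ∈ B₁` and `b` is a top) resp. `t_c \ j` (ALWAYS in `T`: every top serves every
item), and `U ∩ V = L` means `b ⊆ j` resp. `c ⊆ j`.  Along the rank 'items containing a member of `B₁` last, each
group by decreasing… i.e. `r = -(K·[contains some c ∈ B₁] + #·)`', the only uncertified pairs `(b, c)` (`b \ c ∉ T`)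
have `b` free of members of `B₁` (else `b` would be a top), hence never `r b ≤ r c`; all other required entries are
certified and vanish for cardinality reasons.  So the certificate applies and `#B₀ + #B₁ ≤ #T`.
-/

namespace Summit.CriticalPhenomena.PercolationContinuityZ3.Theorems

namespace TopsSuffice

open Finset
open scoped FinsetFamily

variable {α : Type*} [DecidableEq α]

/-- **The two-pool difference inequality** (hp-7 gen 74).  Let `𝒯 ⊆ 𝒜` be finite families of finite sets, `B₀ ⊆ 𝒜` and
`B₁` disjoint families such that every `c ∈ B₁` lies below some `t ∈ 𝒯` and every `b ∈ B₀` containing a member of `B₁`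
belongs to `𝒯`.  Then every family `T` containing all differences `a \ b` (`a ∈ 𝒜`, `b ∈ B₀`) and `t \ c` (`t ∈ 𝒯`, `c ∈ B₁`)
has `#B₀ + #B₁ ≤ #T`.  (`B₁ = ∅`, `B₀ = 𝒜`: Marica–Schönheim; `𝒯 = 𝒜`, `B₀ = ∅`: the Aharoni–Holzman complement form of
the Ahlswede–Daykin inequality.) -/
theorem card_add_card_le_card_of_two_pools (𝒜 𝒯 B₀ B₁ T : Finset (Finset α))
    (h𝒯 : 𝒯 ⊆ 𝒜) (hB₀ : B₀ ⊆ 𝒜) (hdisj : Disjoint B₀ B₁)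
    (hcov : ∀ c ∈ B₁, ∃ t ∈ 𝒯, c ⊆ t)
    (hup : ∀ b ∈ B₀, (∃ c ∈ B₁, c ⊆ b) → b ∈ 𝒯)
    (hT₀ : 𝒜 \\ B₀ ⊆ T) (hT₁ : 𝒯 \\ B₁ ⊆ T) :
    #B₀ + #B₁ ≤ #T := by
  classical
  -- a chosen top above every `c ∈ B₁`
  choose! top htop htopsub using hcov
  -- the items
  set I : Finset (Finset α) := B₀ ∪ B₁ with hI
  have hmemI : ∀ {i : Finset α}, i ∈ I → i ∈ B₀ ∨ i ∈ B₁ := fun hi => mem_union.mp hi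
  have hnot₁ : ∀ {i : Finset α}, i ∈ B₀ → i ∉ B₁ := fun hi => Finset.disjoint_left.mp hdisj hi
  -- ground set, caps, bases, columns
  let S : Finset α := 𝒜.sup id
  have hS : ∀ {a : Finset α}, a ∈ 𝒜 → a ⊆ S := fun ha => le_sup (f := id) ha
  let cap : Finset α → Finset α := fun i => if i ∈ B₀ then i else top i
  have hcap𝒜 : ∀ {i : Finset α}, i ∈ I → cap i ∈ 𝒜 := by
    intro i hi
    rcases hmemI hi with hi₀ | hi₁
    · simp only [cap, if_pos hi₀]; exact hB₀ hi₀
    · simp only [cap, if_neg (fun h => hnot₁ h hi₁)]; exact h𝒯 (htop i hi₁)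
  -- differences `cap i \ j` certified to lie in `T`
  have hcap₀ : ∀ {i j : Finset α}, i ∈ B₀ → j ∈ B₀ → cap i \ j ∈ T := by
    intro i j hi hj
    simp only [cap, if_pos hi]
    exact hT₀ (mem_diffs.mpr ⟨i, hB₀ hi, j, hj, rfl⟩)
  have hcap₀' : ∀ {i j : Finset α}, i ∈ B₀ → i ∈ 𝒯 → j ∈ B₁ → cap i \ j ∈ T := by
    intro i j hi hiT hj
    simp only [cap, if_pos hi]
    exact hT₁ (mem_diffs.mpr ⟨i, hiT, j, hj, rfl⟩)
  have hcap₁ : ∀ {i j : Finset α}, i ∈ B₁ → j ∈ I → cap i \ j ∈ T := by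
    intro i j hi hj
    simp only [cap, if_neg (fun h => hnot₁ h hi)]
    rcases hmemI hj with hj | hj
    · exact hT₀ (mem_diffs.mpr ⟨top i, h𝒯 (htop i hi), j, hj, rfl⟩)
    · exact hT₁ (mem_diffs.mpr ⟨top i, htop i hi, j, hj, rfl⟩)
  -- the rank: items containing a member of `B₁` come last (largest `K + #i`); we hand the certificate `-(…)`
  set K : ℕ := I.sup card + 1 with hK
  have hcardK : ∀ {X : Finset α}, X ∈ I → #X < K := by
    intro X hX
    have := Finset.le_sup (f := card) hX
    omega
  let cls : Finset α → Prop := fun i => ∃ c ∈ B₁, c ⊆ i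
  have hcls₁ : ∀ {i : Finset α}, i ∈ B₁ → cls i := fun {i} hi => ⟨i, hi, subset_rfl⟩
  have hcls_mono : ∀ {i j : Finset α}, cls i → i ⊆ j → cls j :=
    fun ⟨c, hc, hci⟩ hij => ⟨c, hc, hci.trans hij⟩
  let ρ : Finset α → ℕ := fun i => (if cls i then K else 0) + #i
  -- `U ∩ V = U \\ j` inside the ground set
  have hUV : ∀ {A j : Finset α}, A ⊆ S → A ∩ (S \ j) = A \ j := by
    intro A j hAS
    ext x
    simp only [mem_inter, mem_sdiff]
    constructor
    · rintro ⟨hxA, -, hxj⟩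
      exact ⟨hxA, hxj⟩
    · rintro ⟨hxA, hxj⟩
      exact ⟨hxA, hAS hxA, hxj⟩
  -- apply the interval certificate
  have hmain := IntervalCertificate.card_le_card_of_certificate (ι := ↥I) T
    (fun i => -(ρ i : ℤ)) (fun i => cap i \ (i : Finset α)) (fun i => cap i) (fun i => S \ (i : Finset α))
    ?_ ?_ ?_
  · rwa [Fintype.card_coe, hI, card_union_of_disjoint hdisj] at hmain
  · -- `L i = U i ∩ V i`
    rintro ⟨i, hi⟩
    exact (hUV (hS (hcap𝒜 hi))).symm
  · -- `L i ∈ T`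
    rintro ⟨i, hi⟩
    rcases hmemI hi with hi₀ | hi₁
    · exact hcap₀ hi₀ hi₀
    · exact hcap₁ hi₁ hi
  · -- the separation condition along the rank
    rintro ⟨i, hi⟩ ⟨j, hj⟩ hne hr
    right
    have hne' : i ≠ j := fun h => hne (Subtype.ext h)
    have hr' : ρ j ≤ ρ i := by
      have : -(ρ i : ℤ) ≤ -(ρ j : ℤ) := hr
      omega
    have hiK := hcardK hi
    have hjK := hcardK hj
    -- `U i ∩ V j = cap i \ j`
    simp only [hUV (hS (hcap𝒜 hi))]
    rcases hmemI hi with hi₀ | hi₁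
    · -- row `i ∈ B₀`: `cap i = i`
      have hcapi : cap i = i := by simp [cap, if_pos hi₀]
      constructor
      · rcases hmemI hj with hj₀ | hj₁
        · exact hcap₀ hi₀ hj₀
        · have hclsj : cls j := hcls₁ hj₁
          have hclsi : cls i := by
            by_contra h
            simp only [ρ, if_pos hclsj, if_neg h] at hr'
            omega
          exact hcap₀' hi₀ (hup i hi₀ hclsi) hj₁
      · rw [hcapi, sdiff_self]
        intro h0
        have hij : i ⊆ j := sdiff_eq_empty_iff_subset.mp h0
        have hlt : #i < #j := card_lt_card (lt_of_le_of_ne hij hne')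
        by_cases hci : cls i
        · have hcj : cls j := hcls_mono hci hij
          simp only [ρ, if_pos hci, if_pos hcj] at hr'
          omega
        · by_cases hcj : cls j
          · simp only [ρ, if_neg hci, if_pos hcj] at hr'
            omega
          · simp only [ρ, if_neg hci, if_neg hcj] at hr'
            omega
    · -- row `i ∈ B₁`: `cap i = top i`, always certified
      have hcapi : cap i = top i := by simp [cap, if_neg (fun h => hnot₁ h hi₁)]
      refine ⟨hcap₁ hi₁ hj, ?_⟩
      rw [hcapi]
      intro heq
      have hij : i ⊆ j := by
        intro x hx
        by_contra hxj
        have hxt : x ∈ top i \ j := mem_sdiff.mpr ⟨htopsub i hi₁ hx, hxj⟩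
        rw [heq] at hxt
        exact (mem_sdiff.mp hxt).2 hx
      have hlt : #i < #j := card_lt_card (lt_of_le_of_ne hij hne')
      have hci : cls i := hcls₁ hi₁
      have hcj : cls j := hcls_mono hci hij
      simp only [ρ, if_pos hci, if_pos hcj] at hr'
      omega

/-- **(W′) 'tops suffice'** (hp-7 gen 73 conjecture, PROVED): for a finite family `P` and a family `D` of non-members each
lying below some member, `#P + #D ≤ #(P \\ P ∪ Tops \\ D)` with `Tops = {t ∈ P | ∃ d ∈ D, d ⊆ t}` — every member
containing some designated set serves as a minuend for every designated set, and no other second differences are needed. -/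
theorem card_add_card_le_card_diffs_union_tops_diffs (P D : Finset (Finset α)) (hPD : Disjoint P D)
    (hD : ∀ d ∈ D, ∃ p ∈ P, d ⊆ p) :
    #P + #D ≤ #(P \\ P ∪ (P.filter fun t => ∃ d ∈ D, d ⊆ t) \\ D) := by
  refine card_add_card_le_card_of_two_pools P (P.filter fun t => ∃ d ∈ D, d ⊆ t) P D _ (filter_subset _ _)
    subset_rfl hPD ?_ ?_ subset_union_left subset_union_right
  · intro d hd
    obtain ⟨p, hp, hdp⟩ := hD d hd
    exact ⟨p, mem_filter.mpr ⟨hp, d, hd, hdp⟩, hdp⟩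
  · intro b hb hcls
    exact mem_filter.mpr ⟨hb, hcls⟩

/-- (W″): the same with an arbitrary pool of minuends — for `P ⊆ 𝒜` and non-minuends `D` each below some element
of `𝒜`, `#P + #D ≤ #(𝒜 \\ P ∪ {t ∈ 𝒜 | ∃ d ∈ D, d ⊆ t} \\ D)`. -/
theorem card_add_card_le_card_diffs_union_tops_diffs' (𝒜 P D : Finset (Finset α)) (hP : P ⊆ 𝒜)
    (h𝒜D : Disjoint 𝒜 D) (hD : ∀ d ∈ D, ∃ a ∈ 𝒜, d ⊆ a) :
    #P + #D ≤ #(𝒜 \\ P ∪ (𝒜.filter fun t => ∃ d ∈ D, d ⊆ t) \\ D) := by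
  refine card_add_card_le_card_of_two_pools 𝒜 (𝒜.filter fun t => ∃ d ∈ D, d ⊆ t) P D _ (filter_subset _ _) hP
    (disjoint_of_subset_left hP h𝒜D) ?_ ?_ subset_union_left subset_union_right
  · intro d hd
    obtain ⟨a, ha, hda⟩ := hD d hd
    exact ⟨a, mem_filter.mpr ⟨ha, d, hd, hda⟩, hda⟩
  · intro b hb hcls
    exact mem_filter.mpr ⟨hP hb, hcls⟩

/-- The Aharoni–Holzman complement form of the Ahlswede–Daykin inequality as the case `𝒯 = 𝒜`, `B₀ = ∅`: if every
member of `ℬ` lies below some member of `𝒜` then `#ℬ ≤ #(𝒜 \\ ℬ)` (cf.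
`Literature.Combinatorics.SetFamily.card_le_card_diffs_of_forall_exists_sdiff_subset`, whose hypothesis is slightly weaker). -/
theorem card_le_card_diffs_of_forall_exists_subset' (𝒜 ℬ : Finset (Finset α)) (h : ∀ B ∈ ℬ, ∃ A ∈ 𝒜, B ⊆ A) :
    #ℬ ≤ #(𝒜 \\ ℬ) := by
  have h0 := card_add_card_le_card_of_two_pools 𝒜 𝒜 ∅ ℬ (𝒜 \\ ℬ) subset_rfl (empty_subset _)
    (disjoint_empty_left ℬ) h (by simp) (by simp) subset_rfl
  simpa using h0

/-- Marica–Schönheim as the case `D = ∅` of (W′) (sanity check of the statement). -/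
theorem card_le_card_diffs_self (P : Finset (Finset α)) : #P ≤ #(P \\ P) := by
  have h := card_add_card_le_card_diffs_union_tops_diffs P ∅ (disjoint_empty_right P) (by simp)
  simpa using h

/-! ### One-type (MS2) without cross containment (appended, hp-7 gen 74)

The second-order Marica–Schönheim conjecture (`GeneratedDonors.MS2`) with designated differences of ONE type only (`D₂ = ∅`)
follows from the two-pool theorem whenever no member of the other block `Q` contains a designated difference: take
`𝒜 = B₀ = P ∪ Q`, `B₁ = D₅ \ (P ∪ Q)`, `𝒯 = P`.  (Without the containment hypothesis the one-type case is still open: the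
complement-column certificates can fail, memo `FROM-prim-hp-7-g74-TOPS-SUFFICE.md` §0 (D).) -/

/-- **One-type (MS2) without cross containment.**  If every designated set lies below some member of `P` (e.g. `D₅ ⊆ P \\ Q`)
and no member of `Q` contains a designated set, then `#((P ∪ Q) ∪ D₅) ≤ #((P ∪ Q) \\ (P ∪ Q) ∪ P \\ D₅)`. -/
theorem card_le_card_diffs_union_diffs_of_forall_not_subset (P Q D₅ : Finset (Finset α))
    (hD₅ : ∀ d ∈ D₅, ∃ p ∈ P, d ⊆ p) (hQ : ∀ q ∈ Q, ∀ d ∈ D₅, ¬ d ⊆ q) :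
    #((P ∪ Q) ∪ D₅) ≤ #(((P ∪ Q) \\ (P ∪ Q)) ∪ (P \\ D₅)) := by
  have hsplit : (P ∪ Q) ∪ D₅ = (P ∪ Q) ∪ (D₅ \ (P ∪ Q)) := by
    rw [union_sdiff_self_eq_union]
  have hdisj : Disjoint (P ∪ Q) (D₅ \ (P ∪ Q)) := disjoint_sdiff
  rw [hsplit, card_union_of_disjoint hdisj]
  refine card_add_card_le_card_of_two_pools (P ∪ Q) P (P ∪ Q) (D₅ \ (P ∪ Q)) _ subset_union_left subset_rfl
    hdisj ?_ ?_ subset_union_left ?_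
  · intro d hd
    exact hD₅ d (mem_sdiff.mp hd).1
  · rintro b hb ⟨c, hc, hcb⟩
    rcases mem_union.mp hb with hbP | hbQ
    · exact hbP
    · exact absurd hcb (hQ b hbQ c (mem_sdiff.mp hc).1)
  · exact (diffs_subset_left sdiff_subset).trans subset_union_right

/-- The same from the hypotheses of `GeneratedDonors.MS2` with `D₂ = ∅`: one-type (MS2) holds for every instance in which no
member of `Q` contains a designated type-5 difference. -/
theorem card_le_card_diffs_union_diffs_of_subset_diffs (P Q D₅ : Finset (Finset α)) (hD₅ : D₅ ⊆ P \\ Q)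
    (hQ : ∀ q ∈ Q, ∀ d ∈ D₅, ¬ d ⊆ q) :
    #((P ∪ Q) ∪ D₅) ≤ #(((P ∪ Q) \\ (P ∪ Q)) ∪ (P \\ D₅)) := by
  refine card_le_card_diffs_union_diffs_of_forall_not_subset P Q D₅ (fun d hd => ?_) hQ
  obtain ⟨p, hp, q, -, rfl⟩ := mem_diffs.mp (hD₅ hd)
  exact ⟨p, hp, sdiff_subset⟩

end TopsSuffice

end Summit.CriticalPhenomena.PercolationContinuityZ3.Theorems
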